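/-
Copyright (c) 2026 the pub-hodgecm-mathlib formalisation cell (harness21).  Prover seat hodgecm-mathlib-LH4-p05 (g8), Track A «(D-RAM) FOUR-FRAME» squad, helper lane on
h413 = stmt-HodgeConjecture-24833 (count-neutral).  Heir dealer∕pen LH4-plan (g13) WORD #82 (B) «B2b-3 + END = LH4-p05 (chain owner)»; the END junction of the (β) chain
after LH4-p13 (g8)'s ★ p860337 ((A″) PROVED at the letters of record) and LH4-p11 (g8)'s ★ p860156 ((β-BAL) ⇐ eightfold odd-character vanishing).  2026-09-04.
-/
import Summits.HodgeConjecture.HodgeConjecture.Theorems.F0P3cDyRamCleanSgnOfLabelDichotomy       -- ★ p860063 (this seat): `dyadicFence_cleanSgnFrameConstLawAt_derived_ofRecord_of` ((α′) ∧ (A″) ∧ (β-BAL) ⇒ (β) at the record letters)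
import Summits.HodgeConjecture.HodgeConjecture.Theorems.F0P3cDyRamCleanLabelDichotomyOfRecord     -- ★ p860337 (LH4-p13 (g8), (L-lab-18)): (A″) PROVED `dyadicFence_cleanLabelDichotomyLawAt_derived_ofRecord`
import Summits.HodgeConjecture.HodgeConjecture.Theorems.F0P3cDyRamCleanLabelBalanceOfEightfold     -- ★ p860156 (LH4-p11 (g8), (β-BAL-4a)): `dyadicFence_cleanLabelKappaBalanceLawAt_derived_ofRecord_of_eightfold`
import HarnessLib

/-!
# Crux `H413`, line LH4 «(D-RAM) FOUR-FRAME» — THE END JUNCTION OF THE (β) CHAIN: the tier-0 ED. 6 letter `stub_law_cleanSgn` follows from the κ-BALANCE letter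
# (β-BAL) ALONE, and from the EIGHTFOLD ODD-CHARACTER VANISHING in the unimodular diagonal model ALONE

Cell `hodgecm-mathlib` (D-0151), FLOOR 0, crux item H413 = `stmt-HodgeConjecture-24833`, route `HCCMUnconditional`; squad F0∕P3c∕LH4.  THEOREMS ONLY (no `def`, no instance, no
notation, no `sorry`, default heartbeats); ★-only imports; lane `--supports stmt-HodgeConjecture-24833 --as helper`; pays NO row, states NO law (both theorems are implications whose
hypothesis is an OPEN census statement); import cone ∌ the (β) consumer ★ p859751 `…TransvPlusLawOfCleanLevels` (chair LH4-r01 (g8) BOX MP non-circularity test (ii)).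

THE COMPOSITION.  ★ p860063 §3 gives `stub_law_cleanSgn`'s type `∀ σ ϖ d t, DyadicFence (CleanSgnFrameConstLawAt n0DerivedOfRecord mcOfRecord σ ϖ d t)` from the two
letters (A″) `CleanLabelDichotomyLawAt` and (β-BAL) `CleanLabelKappaBalanceLawAt` at the schedules of record ((α′) being ★ p859831).  LH4-p13 (g8)'s ★ p860337 PROVES (A″) there
(`dyadicFence_cleanLabelDichotomyLawAt_derived_ofRecord`: behind the fence the datum is dyadic, `d ≥ 2`, and every clean-shell vertex is labelled by some unit class), so
(§1) **(β-BAL) ALONE ⇒ `stub_law_cleanSgn`'s type**.  LH4-p11 (g8)'s ★ p860156 reduces (β-BAL) at the record letters to ONE frame-free statement in the unimodular diagonal model —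
the EIGHTFOLD ODD-CHARACTER VANISHING `h8`: for every `σ`-fixed non-norm unit `u` with the index-two dichotomy, every element datum above `n0DerivedOfRecord d`,
`T = diag(α, β, 1)` and each slot `i`, `Σ_{s : Fin 3 → Bool} (−1)^{s_i}·#{M : type-0 vertex of diag(u^{s}) | T·M = M, clean shell, class-`+` value set} = 0` — so
(§2) **`h8` ALONE ⇒ `stub_law_cleanSgn`'s type**.  What remains of the (β) road is `h8` = the labelled-odd Stage A (★ p860280 engine, LH4-p10 (g6) (B2a-2)) + Stage B
(label reads LH4-p13, character counts LH4-p14 (B3), strata by name, table sum = this seat's B2b-3).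
HONEST LABEL.  Count-neutral composition; `h8`, (β-BAL), (β) and the tier-0 T₊ row are OPEN; `HC_CM` is proved only modulo the 7 printed citations (2 remaining named inputs:
hLiu418 = `stmt-HodgeConjecture-24832`, h413 = `stmt-HodgeConjecture-24833`) until rung 0 closes.

## References
* [Rogawski1990] J. D. Rogawski, *Automorphic Representations of Unitary Groups in Three Variables*, Ann. of Math. Stud. 123 (1990): §4.9 Prop. 4.9.1 (a)(b) p. 55, §4.10 p. 58.
* [LanglandsShelstad1987] R. P. Langlands, D. Shelstad, *On the definition of transfer factors*, Math. Ann. 278 (1987), §1.3, §3.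
* [Kottwitz1986BaseChangeUnits] R. E. Kottwitz, *Base change for unit elements of Hecke algebras*, Compositio Math. 60 (1986), §1 pp. 240–241.
-/

set_option autoImplicit false

noncomputable section

namespace Summit.HodgeConjecture.HodgeConjecture.Cruxes.H413.F0P3cDyRamCleanSgnOfEightfold

open Literature.NumberTheory.Automorphic Literature.NumberTheory.Automorphic.HermitianLattice Literature.NumberTheory.Automorphic.UnitaryGroup
open Literature.NumberTheory.Automorphic.UnitaryLatticeTree Literature.NumberTheory.Automorphic.UnitaryThreeFourFrame
open Summit.HodgeConjecture.HodgeConjecture.Cruxes.H413.F0P3cDyRamFourFrameLawDefs (DyadicFence)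
open Summit.HodgeConjecture.HodgeConjecture.Cruxes.H413.F0P3cDyRamFourFramePieces
open Summit.HodgeConjecture.HodgeConjecture.Cruxes.H413.F0P3cDyRamFourFrameCensusDefs
open Summit.HodgeConjecture.HodgeConjecture.Cruxes.H413.F0P3cDyRamStageOneBDefs
open Summit.HodgeConjecture.HodgeConjecture.Cruxes.H413.F0P3cDyRamStageOneBDerivedDefs
open Summit.HodgeConjecture.HodgeConjecture.Cruxes.H413.F0P3cDyRamCleanLabelDefs
open Summit.HodgeConjecture.HodgeConjecture.Cruxes.H413.F0P3cDyRamCleanSgnOfLabelDichotomy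
open Summit.HodgeConjecture.HodgeConjecture.Cruxes.H413.F0P3cDyRamCleanLabelDichotomyOfRecord
open Summit.HodgeConjecture.HodgeConjecture.Cruxes.H413.F0P3cDyRamCleanLabelBalanceOfEightfold
open scoped Matrix MatrixGroups WithZero Valued

/-! ## §1  (β-BAL) alone ⇒ the ED. 6 letter -/

/-- **`stub_law_cleanSgn`'S TYPE FROM (β-BAL) ALONE.**  With (α′) ★ p859831 and (A″) ★ p860337 PROVED at `(n0DerivedOfRecord, mcOfRecord)`: if the κ-balance of the two label
classes on the clean shell holds (dyadically fenced) at every datum at the same schedules, then so does (β) `CleanSgnFrameConstLawAt` — the type of the tier-0 ED. 6 letter.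
[cite: Rogawski1990, §4.9 Prop. 4.9.1 (a)(b) p. 55] [cite: LanglandsShelstad1987, §1.3, §3] -/
theorem dyadicFence_cleanSgnFrameConstLawAt_derived_ofRecord_of_balance
    (hbal : ∀ {K : Type} [Field K] [Valued K ℤᵐ⁰] [CompleteSpace K] [Fintype 𝓀[K]] (σ : K →+* K) (ϖ : K) (d t : ℕ),
      DyadicFence (K := K) (CleanLabelKappaBalanceLawAt n0DerivedOfRecord mcOfRecord σ ϖ d t)) :
    ∀ {K : Type} [Field K] [Valued K ℤᵐ⁰] [CompleteSpace K] [Fintype 𝓀[K]] (σ : K →+* K) (ϖ : K) (d t : ℕ),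
      DyadicFence (K := K) (CleanSgnFrameConstLawAt n0DerivedOfRecord mcOfRecord σ ϖ d t) :=
  dyadicFence_cleanSgnFrameConstLawAt_derived_ofRecord_of dyadicFence_cleanLabelDichotomyLawAt_derived_ofRecord hbal

/-! ## §2  The eightfold odd-character vanishing alone ⇒ the ED. 6 letter -/

/-- **`stub_law_cleanSgn`'S TYPE FROM THE EIGHTFOLD ODD-CHARACTER VANISHING ALONE.**  If, behind the dyadic fence at every datum, for every `σ`-fixed non-norm unit `u` with the
index-two dichotomy, every element datum above `n0DerivedOfRecord d`, `T = diag(α, β, 1)` and each slot `i : Fin 3`, the signed eightfold sum of the class-`+` clean-shell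
type-0 fixed counts of the forms `diag(u^{s})` with the sign `(−1)^{s_i}` vanishes (LH4-p11 (g8)'s `h8`, VERBATIM), then (β) holds at the letters of record — ★ p860156
(`h8 ⇒ (β-BAL)`) composed with §1. [cite: Rogawski1990, §4.9 Prop. 4.9.1 (a)(b) p. 55, §4.10 p. 58] [cite: LanglandsShelstad1987, §1.3, §3] [cite: Kottwitz1986BaseChangeUnits, §1 pp. 240–241] -/
theorem dyadicFence_cleanSgnFrameConstLawAt_derived_ofRecord_of_eightfold
    (h8 : ∀ {K : Type} [Field K] [Valued K ℤᵐ⁰] [CompleteSpace K] [Fintype 𝓀[K]] (σ : K →+* K) (ϖ : K) (d t : ℕ),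
      Valued.v (2 : K) < 1 → IsRamifiedQuadraticDatum σ ϖ d t →
      ∀ (u : K), σ u = u → Valued.v u = 1 → (¬ ∃ z : K, z * σ z = u) →
        (∀ x : K, σ x = x → x ≠ 0 → (∃ z : K, z * σ z = x) ∨ ∃ z : K, z * σ z = u * x) →
      ∀ (α β : K) (n₁ n₂ n₃ : ℕ), IsElementDatum σ ϖ (n0DerivedOfRecord d) α β n₁ n₂ n₃ →
      ∀ (T : GL (Fin 3) K), (T : Matrix (Fin 3) (Fin 3) K) = Matrix.diagonal ![α, β, 1] →
      ∀ i : Fin 3,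
        (∑ s : Fin 3 → Bool, (if s i then (-1 : ℤ) else 1) *
          ({M : Submodule 𝒪[K] (Fin 3 → K) | IsVertexLattice σ ϖ (Matrix.diagonal fun j => if s j then u else (1 : K)) 0 M ∧ mapGL T M = M ∧
              ((LatticeInLevel ϖ (d % 2) (Matrix.diagonal ![α - 1, β - 1, 0]) M ∧ ¬ LatticeInLevel ϖ (d % 2 + 1) (Matrix.diagonal ![α - 1, β - 1, 0]) M ∧
                  LatticeInLevel ϖ (mcOfRecord d) (Matrix.diagonal ![(α - 1) * (α - 1), (β - 1) * (β - 1), 0]) M) ∧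
                {v | ∃ y ∈ M, Valued.v ((ϖ ^ mstarOfRecord d)⁻¹ *
                    (v - ((if s 0 then u else (1 : K)) * (α - 1) * (y 0 * σ (y 0)) + (if s 1 then u else (1 : K)) * (β - 1) * (y 1 * σ (y 1))))) ≤ 1} =
                  valueSetMod σ ϖ (mstarOfRecord d) (xPlus σ ϖ d))}.ncard : ℤ)) = 0) :
    ∀ {K : Type} [Field K] [Valued K ℤᵐ⁰] [CompleteSpace K] [Fintype 𝓀[K]] (σ : K →+* K) (ϖ : K) (d t : ℕ),
      DyadicFence (K := K) (CleanSgnFrameConstLawAt n0DerivedOfRecord mcOfRecord σ ϖ d t) :=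
  dyadicFence_cleanSgnFrameConstLawAt_derived_ofRecord_of_balance (dyadicFence_cleanLabelKappaBalanceLawAt_derived_ofRecord_of_eightfold h8)

end Summit.HodgeConjecture.HodgeConjecture.Cruxes.H413.F0P3cDyRamCleanSgnOfEightfold

end
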